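import Summits.HodgeConjecture.HodgeConjecture.Theorems.F0P2cSocketC                               -- ★ (C♭) frame currency; ★ `F0P2cStubCI.rhoAtLine_chi_isIrreducible` (CI)
import Summits.HodgeConjecture.HodgeConjecture.Theorems.H413LineClassTransportOfEquiv              -- ★ `rhoAtLine_lineClassTransport_of_equiv` ((C′) for any `ιV` from the master equivalence)
import Literature.NumberTheory.Automorphic.Liu2021.Def411WeilCarriersAtLineClassTransportAllFrames -- ★ `Def411WeilCarriers.lineClassTransport_equiv` (the master equivalence, every rank ∕ frame)
import Summits.HodgeConjecture.HodgeConjecture.Theorems.K2E2TrBijectiveOfInjective   -- ★ socket closer landed: `trBijectiveOfInjective` (RE-TIE BY IMPORT, ED. 2)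
import Summits.HodgeConjecture.HodgeConjecture.Theorems.K2E2TrHasFinComponentOfBijective   -- ★ socket closer landed: `trHasFinComponentOfBijective` (RE-TIE BY IMPORT, ED. 2)
import Summits.HodgeConjecture.HodgeConjecture.Theorems.K2E2TrHasFinComponentOfLocFEq   -- ★ socket closer landed: `trHasFinComponentOfLocFEq` (RE-TIE BY IMPORT, ED. 2)
import Summits.HodgeConjecture.HodgeConjecture.Theorems.K2E2TrFinComponentTransport   -- ★ socket closer landed: `finComponentTransport` (RE-TIE BY IMPORT, ED. 2)
import HarnessLib

/-!
RE-TIE EDITION (2026-09-03T22:20Z): every landed socket of this module is now `:= @<landed decl>` BY IMPORT (statement bytes frozen); see the per-theorem comments.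

# K2 ∕ E2 «ThetaExhaustionByRigidity» — tier-1 sockets, unit **CLASS-TRANSPORT** (finite components along the line-class equivalence)

Track B «K2-LIT», engine E2, crux H413 (`stmt-HodgeConjecture-24833`), route `route-HodgeConjecture-HCCMUnconditional`.  Tier-0 line:
`Cruxes/H413/Lines/K2_E2_ThetaExhaustionByRigidity.lean` (stub `stub_finComponentTransport`, `def StubFinComponentTransport`).  Sockets
`theorem sig_K2E2Tr… : ‹statement› := by sorry`, one per planned tier-2 file `Theorems/K2E2Tr….lean`.  No `def`∕`instance`∕`notation`; imports ★ only;
the closer `sig_K2E2TrFinComponentTransport` = tier-0 `StubFinComponentTransport` VERBATIM.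
CHAIN: `sig_K2E2TrBijectiveOfInjective` (Schur-free: a non-zero subrepresentation of an irreducible is everything; Mathlib `Representation.IsIrreducible`) +
`sig_K2E2TrHasFinComponentOfBijective` (`HasFinComponent` along an equivariant bijection; ★ pattern `F0LD1MeetsOfOrthogonalCopy.hasFinComponent_of_equiv`) +
`sig_K2E2TrHasFinComponentOfLocFEq` (★ (C′) = `rhoAtLine_lineClassTransport_of_equiv lineClassTransport_equiv` at `(a′, a)`, composed) → `sig_K2E2TrFinComponentTransport` (with CI ★
`F0P2cStubCI.rhoAtLine_chi_isIrreducible` in the TEL frame).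
HONEST LABEL: HC_CM is proved only modulo the 7 printed citations (2 remaining named inputs: hLiu418 = stmt-HodgeConjecture-24832, h413 =
stmt-HodgeConjecture-24833) until rung 0 closes; nothing here changes any count.
-/

set_option Elab.async false
set_option autoImplicit false
set_option linter.dupNamespace false

namespace Summit.HodgeConjecture.HodgeConjecture.Cruxes.H413.K2E2ThetaExhaustionByRigidity.ClassTransport

open scoped TensorProduct Matrix ComplexOrder
open NumberField NumberField.InfinitePlace IsDedekindDomain MeasureTheory
open Literature.NumberTheory Literature.NumberTheory.Automorphic Literature.NumberTheory.Automorphic.UnitaryGroup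
open Literature.NumberTheory.Automorphic.Liu2021
open Literature.NumberTheory.Automorphic.Liu2021.Def411WeilCarriers
open Literature.NumberTheory.Automorphic.Liu2021.Def411WeilCarriersDoubling
open Literature.NumberTheory.Automorphic.IdeleClassGroup
open Literature.NumberTheory.GelbartRogawski1991 Literature.NumberTheory.GelbartRogawski1991.UnitaryDualPair
open Literature.NumberTheory.GelbartRogawski1991.UnitaryDualPair.WeilCoinv
open Literature.RepresentationTheory Literature.RepresentationTheory.Liu2021
open Summit.HodgeConjecture.CorCM

/-- **sig TR-1 (size S) — an injective intertwiner from a non-zero representation INTO an irreducible one is bijective.**  The range of `f` is a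
subrepresentation of the irreducible `ρ`, non-zero because `V` is non-trivial and `f` injective, hence `⊤` (Mathlib `Representation.IsIrreducible` =
`IsSimpleOrder (Subrepresentation ρ)`; compare `Representation.IsIrreducible.bijective_or_eq_zero`, which needs BOTH sides irreducible).
[cite: Liu2021, App. D Lem. D.1 (1) (irreducibility of `ω(μ, ε, χ)`, l. 5227)] [cite: BorelJacquet1979, §4.6]
size: S · deps: Mathlib `Representation.Subrepresentation`, `IntertwiningMap` · unit: CLASS-TRANSPORT · tier-2 target `Theorems/K2E2TrBijectiveOfInjective.lean` -/
theorem sig_K2E2TrBijectiveOfInjective :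
    ∀ {G : Type} [Group G] {V W : Type} [AddCommGroup V] [Module ℂ V] [AddCommGroup W] [Module ℂ W]
      (σ : Representation ℂ G V) (ρ : Representation ℂ G W),
      ρ.IsIrreducible → Nontrivial V → ∀ f : σ.IntertwiningMap ρ, Function.Injective f → Function.Bijective f :=
  @Summit.HodgeConjecture.HodgeConjecture.Cruxes.H413.K2E2TrBijectiveOfInjective.trBijectiveOfInjective  -- ★ RE-TIED BY IMPORT (statement bytes above FROZEN ∕ unchanged)

/-- **sig TR-2 (size S) — `HasFinComponent` passes along an equivariant BIJECTION of the finite component.**  If `σ` is a finite component of the discrete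
`P` (an injective `U(J)(𝔸_{F,f})`-intertwiner `σ → P.finRep`, ★ `DiscreteAutomorphicRep.HasFinComponent`) and `e : σ → ρ` is a bijective intertwiner,
then `ρ` is a finite component of `P` (compose with the inverse intertwiner `IntertwiningMap.ofBijective`).  Pattern: ★
`F0LD1MeetsOfOrthogonalCopy.hasFinComponent_of_equiv` (transport in `P`); here the transport is in `σ`.
[cite: BorelJacquet1979, §4.6] [cite: Flath1979, §2]
size: S · deps: ★ `HasFinComponent`, Mathlib `Representation.IntertwiningMap` · unit: CLASS-TRANSPORT · tier-2 target `Theorems/K2E2TrHasFinComponentOfBijective.lean` -/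
theorem sig_K2E2TrHasFinComponentOfBijective :
    ∀ {F E : Type} [Field F] [NumberField F] [Field E] [NumberField E] [Algebra F E] {c : E ≃ₐ[F] E} {N : ℕ}
      {J : Matrix (Fin N) (Fin N) E} (μ : Measure (adelicGroupData F E c N J).automorphicQuotient)
      [(adelicGroupData F E c N J).IsAutomorphicMeasure μ]
      (P : DiscreteAutomorphicRep (adelicGroupData F E c N J) μ)
      {V W : Type} [AddCommGroup V] [Module ℂ V] [AddCommGroup W] [Module ℂ W]
      (σ : Representation ℂ (finAdelic F E c N J) V) (ρ : Representation ℂ (finAdelic F E c N J) W) (e : σ.IntertwiningMap ρ),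
      Function.Bijective e → P.HasFinComponent σ → P.HasFinComponent ρ :=
  @Summit.HodgeConjecture.HodgeConjecture.Cruxes.H413.K2E2TrHasFinComponentOfBijective.trHasFinComponentOfBijective  -- ★ RE-TIED BY IMPORT (statement bytes above FROZEN ∕ unchanged)

set_option synthInstance.maxHeartbeats 400000 in
set_option maxHeartbeats 8000000 in
/-- **sig TR-3 (size S) — Liu's carrier as a finite component depends on the line only through its finite classes.**  For ANY `ιV : U(H)(𝔸_f) →* U(diag dV)(𝔸_f)`,
any rank `N`, if `locF a′ = locF a` and `ω_H(μ, a, χ) = rhoAtLine …[e₁] ιV a χ` is a finite component of `P`, so is `ω_H(μ, a′, χ)`: compose the injective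
intertwiner `ω(a) ↪ P.finRep` with the ★ injective intertwiner `ω(a′) ↪ ω(a)` of (C′) = ★ `H413LineClassTransportOfEquiv.rhoAtLine_lineClassTransport_of_equiv`
applied to ★ `Def411WeilCarriers.lineClassTransport_equiv`, at `(χ_V := toHeckeCharacter L μ)` and the pair `(a′, a)`.
[cite: Liu2021, Def. 4.11 (l. 2092–2096); Def. 4.12; App. D §D.1 Step 1 footnote (l. 5215)] [cite: GelbartRogawski1991, §3.1 Prop. 3.1.1 p. 455; Remark p. 457]
[cite: MoeglinVignerasWaldspurger1987, Chap. 3 §I.1–I.3]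
audit: GR91 p455 (Prop. 3.1.1: the oscillator representation of `U(V) × U(W)` at a splitting character; dependence on the class of `W`) · size: S ·
deps: ★ `rhoAtLine_lineClassTransport_of_equiv`, ★ `lineClassTransport_equiv` · unit: CLASS-TRANSPORT · tier-2 target `Theorems/K2E2TrHasFinComponentOfLocFEq.lean` -/
theorem sig_K2E2TrHasFinComponentOfLocFEq :
    ∀ (L : Type) [Field L] [NumberField L] [IsCMField L] (N : ℕ) (H : Matrix (Fin N) (Fin N) L)
      {n' : ℕ} (e₁ : Fin N × Fin 1 ≃ Fin n') (dV : Fin N → L) (hdV : ∀ i, IsCMField.complexConj L (dV i) = dV i)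
      (hdV0 : ∀ i, dV i ≠ 0)
      (ιV : finAdelic (↥(maximalRealSubfield L)) L (IsCMField.complexConj L) N H →*
          finAdelic (↥(maximalRealSubfield L)) L (IsCMField.complexConj L) N (Matrix.diagonal dV))
      (μA : Measure (adelicGroupData (↥(maximalRealSubfield L)) L (IsCMField.complexConj L) N H).automorphicQuotient)
      [(adelicGroupData (↥(maximalRealSubfield L)) L (IsCMField.complexConj L) N H).IsAutomorphicMeasure μA]
      (P : DiscreteAutomorphicRep (adelicGroupData (↥(maximalRealSubfield L)) L (IsCMField.complexConj L) N H) μA)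
      (μ : Literature.NumberTheory.Automorphic.IdeleClassGroup L →ₜ* Circle) (hμ : IsConjugateSymplectic L μ)
      (a a' : (↥(maximalRealSubfield L))ˣ) (χ : Chi (↥(maximalRealSubfield L)) L (IsCMField.complexConj L)),
      locF (↥(maximalRealSubfield L)) (imagUnitSq L) a' = locF (↥(maximalRealSubfield L)) (imagUnitSq L) a →
      P.HasFinComponent
        (rhoAtLine (↥(maximalRealSubfield L)) L (IsCMField.complexConj L) N e₁ (Matrix.diagonal dV)
          (complexConj_imagUnit L) (imagUnit_ne_zero L) (imagUnit_mul_self L) (realDiagonal_isSymm L dV hdV)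
          (isUnit_det_realDiagonal L dV hdV hdV0) (realDiagonal_map L dV hdV).symm
          (fun b => isCompatible_chiSplittingLine L e₁ dV hdV hdV0 (toHeckeCharacter L μ)
            (isUnitary_toHeckeCharacter L μ) ((isOscillatorChar_toHeckeCharacter_iff μ).mpr hμ)
            (TW (↥(maximalRealSubfield L)) b) (isSymm_TW (↥(maximalRealSubfield L)) b)
            (isUnit_det_TW (↥(maximalRealSubfield L)) b) (JW (↥(maximalRealSubfield L)) L b)
            (JW_eq (↥(maximalRealSubfield L)) L b)) ιV a χ) →
      P.HasFinComponent
        (rhoAtLine (↥(maximalRealSubfield L)) L (IsCMField.complexConj L) N e₁ (Matrix.diagonal dV)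
          (complexConj_imagUnit L) (imagUnit_ne_zero L) (imagUnit_mul_self L) (realDiagonal_isSymm L dV hdV)
          (isUnit_det_realDiagonal L dV hdV hdV0) (realDiagonal_map L dV hdV).symm
          (fun b => isCompatible_chiSplittingLine L e₁ dV hdV hdV0 (toHeckeCharacter L μ)
            (isUnitary_toHeckeCharacter L μ) ((isOscillatorChar_toHeckeCharacter_iff μ).mpr hμ)
            (TW (↥(maximalRealSubfield L)) b) (isSymm_TW (↥(maximalRealSubfield L)) b)
            (isUnit_det_TW (↥(maximalRealSubfield L)) b) (JW (↥(maximalRealSubfield L)) L b)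
            (JW_eq (↥(maximalRealSubfield L)) L b)) ιV a' χ) :=
  @Summit.HodgeConjecture.HodgeConjecture.Cruxes.H413.K2E2TrHasFinComponentOfLocFEq.trHasFinComponentOfLocFEq  -- ★ RE-TIED BY IMPORT (statement bytes above FROZEN ∕ unchanged)

set_option synthInstance.maxHeartbeats 400000 in
set_option maxHeartbeats 8000000 in
/-- **sig TR-4 = the tier-0 stub `StubFinComponentTransport` VERBATIM (closer, size S given TR-1 + TR-2 + TR-3).**  In the (C♭) TEL frame (pinned `ιV`):
an irreducible finite component `σ` of `P` embedding into `ω_H(μ, a, χ)` and `locF a′ = locF a` give `P.HasFinComponent ω_H(μ, a′, χ)`.  PLAN: `ω_H(μ,a,χ)` is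
irreducible (★ `F0P2cStubCI.rhoAtLine_chi_isIrreducible L H e₁ dV hdV hdV0 g hg ιV hιV μ hμ a χ`), `σ` irreducible hence non-trivial, so the injective
`f : σ ↪ ω_H` is bijective (TR-1); TR-2 moves `HasFinComponent` from `σ` to `ω_H(μ,a,χ)`; TR-3 moves it to `a′`.
[cite: Liu2021, Def. 4.11 (l. 2092–2096); Def. 4.12; App. D Lem. D.1 (1)] [cite: GelbartRogawski1991, §3.1 Prop. 3.1.1 p. 455] [cite: Flath1979, §2]
size: S · deps: TR-1, TR-2, TR-3, ★ CI · unit: CLASS-TRANSPORT · re-ties tier-0 `stub_finComponentTransport` · tier-2 target `Theorems/K2E2TrFinComponentTransport.lean` -/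
theorem sig_K2E2TrFinComponentTransport :
    ∀ (L : Type) [Field L] [NumberField L] [IsCMField L] (ι : L →+* ℂ) (H : Matrix (Fin 3) (Fin 3) L) (T : GL (Fin 3) ℂ)
      (hT : (T : Matrix (Fin 3) (Fin 3) ℂ)ᴴ * H.map ι * (T : Matrix (Fin 3) (Fin 3) ℂ) = Literature.Geometry.ComplexHyperbolic.BallModel.J),
      (∀ τ' : L →+* ℂ, InfinitePlace.mk τ' ≠ InfinitePlace.mk ι → (H.map τ').PosDef) → 2 ≤ Module.finrank ℚ ↥(maximalRealSubfield L) →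
      ∀ {n' : ℕ} (e₁ : Fin 3 × Fin 1 ≃ Fin n') (dV : Fin 3 → L) (hdV : ∀ i, IsCMField.complexConj L (dV i) = dV i)
        (hdV0 : ∀ i, dV i ≠ 0) (g : GL (Fin 3) L)
        (hg : ((g : Matrix (Fin 3) (Fin 3) L).map (cmConjRingHom L))ᵀ * H * (g : Matrix (Fin 3) (Fin 3) L) = Matrix.diagonal dV)
        (ιV : finAdelic (↥(maximalRealSubfield L)) L (IsCMField.complexConj L) 3 H →*
            finAdelic (↥(maximalRealSubfield L)) L (IsCMField.complexConj L) 3 (Matrix.diagonal dV)),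
          (∀ k, ((ιV k : finAdelic (↥(maximalRealSubfield L)) L (IsCMField.complexConj L) 3 (Matrix.diagonal dV)) :
              GL (Fin 3) (FiniteAdeleRing (𝓞 L) L)) =
            (toFinAdeleGL L 3 g)⁻¹ * (k : GL (Fin 3) (FiniteAdeleRing (𝓞 L) L)) * toFinAdeleGL L 3 g) →
          ∀ (μA : Measure (adelicGroupData (↥(maximalRealSubfield L)) L (IsCMField.complexConj L) 3 H).automorphicQuotient)
            [(adelicGroupData (↥(maximalRealSubfield L)) L (IsCMField.complexConj L) 3 H).IsAutomorphicMeasure μA]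
            (W : Type) [AddCommGroup W] [Module ℂ W]
            (σ : Representation ℂ (finAdelic (↥(maximalRealSubfield L)) L (IsCMField.complexConj L) 3 H) W),
            σ.IsIrreducible →
          ∀ (P : DiscreteAutomorphicRep (adelicGroupData (↥(maximalRealSubfield L)) L (IsCMField.complexConj L) 3 H) μA)
            (μ : Literature.NumberTheory.Automorphic.IdeleClassGroup L →ₜ* Circle) (hμ : IsConjugateSymplectic L μ)
            (a a' : (↥(maximalRealSubfield L))ˣ) (χ : Chi (↥(maximalRealSubfield L)) L (IsCMField.complexConj L)),
            P.HasFinComponent σ →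
            (∃ f : σ.IntertwiningMap
                (rhoAtLine (↥(maximalRealSubfield L)) L (IsCMField.complexConj L) 3 e₁ (Matrix.diagonal dV)
                  (complexConj_imagUnit L) (imagUnit_ne_zero L) (imagUnit_mul_self L) (realDiagonal_isSymm L dV hdV)
                  (isUnit_det_realDiagonal L dV hdV hdV0) (realDiagonal_map L dV hdV).symm
                  (fun a => isCompatible_chiSplittingLine L e₁ dV hdV hdV0 (toHeckeCharacter L μ)
                    (isUnitary_toHeckeCharacter L μ) ((isOscillatorChar_toHeckeCharacter_iff μ).mpr hμ)
                    (TW (↥(maximalRealSubfield L)) a) (isSymm_TW (↥(maximalRealSubfield L)) a)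
                    (isUnit_det_TW (↥(maximalRealSubfield L)) a) (JW (↥(maximalRealSubfield L)) L a)
                    (JW_eq (↥(maximalRealSubfield L)) L a)) ιV a χ),
              Function.Injective f) →
            locF (↥(maximalRealSubfield L)) (imagUnitSq L) a' = locF (↥(maximalRealSubfield L)) (imagUnitSq L) a →
            P.HasFinComponent
              (rhoAtLine (↥(maximalRealSubfield L)) L (IsCMField.complexConj L) 3 e₁ (Matrix.diagonal dV)
                (complexConj_imagUnit L) (imagUnit_ne_zero L) (imagUnit_mul_self L) (realDiagonal_isSymm L dV hdV)
                (isUnit_det_realDiagonal L dV hdV hdV0) (realDiagonal_map L dV hdV).symm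
                (fun a => isCompatible_chiSplittingLine L e₁ dV hdV hdV0 (toHeckeCharacter L μ)
                  (isUnitary_toHeckeCharacter L μ) ((isOscillatorChar_toHeckeCharacter_iff μ).mpr hμ)
                  (TW (↥(maximalRealSubfield L)) a) (isSymm_TW (↥(maximalRealSubfield L)) a)
                  (isUnit_det_TW (↥(maximalRealSubfield L)) a) (JW (↥(maximalRealSubfield L)) L a)
                  (JW_eq (↥(maximalRealSubfield L)) L a)) ιV a' χ) :=
  @Summit.HodgeConjecture.HodgeConjecture.Cruxes.H413.K2E2TrFinComponentTransport.finComponentTransport  -- ★ RE-TIED BY IMPORT (statement bytes above FROZEN ∕ unchanged)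

end Summit.HodgeConjecture.HodgeConjecture.Cruxes.H413.K2E2ThetaExhaustionByRigidity.ClassTransport
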